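import Summits.AnomalousDissipation.AnomalousDissipation.Theorems.SolenoidalFractalHomogenisationLagrangianStepCellChainFastSlaving
import Summits.AnomalousDissipation.AnomalousDissipation.Theorems.SolenoidalFractalHomogenisationLagrangianStepModeCoeffContinuity
import Summits.AnomalousDissipation.AnomalousDissipation.Theorems.SolenoidalFractalHomogenisationLagrangianStepCellCorrectorContent
import HarnessLib

/-!
# K1L_D (stmt-AnomalousDissipation-27980): (V_mod) flat stage, block (ss) — THE BRIDGE between a window PROPAGATOR and w1's continuous
# mode representatives, and the TIME PERIOD of the cell carrier
(helper; `--supports 27980 --as helper`; prover ad-sawtooth-k1loc-p1 g15; serves every regime of the certifier's table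
`Cruxes/LagrangianRenormalisationStep/Lines/onelevel-ss-regimes.md` v2: the tools T-G/L-sb/T-I live on weak solutions (`CellChain.modeRep`), the texts
`VmodFlat.SSMode_textE(H)` on propagators `Torus.IsPropagator`.)

* §1 `cell_add_period`, `cell_add_nat_mul_period`, `period_stretch_stretch`, **`cellField_add_nat_mul_period`** — the cell carrier of
  the design `W.stretch M` replayed at cell viscosity `ν` is periodic in time with period `P = M·W.period/ν` (the envelope reads `fract(t/period)`),
  so a window starting at `s ∈ P·ℕ` sees the carrier FROM PHASE 0 (reduction (R-f) of the table): `fun τ => cellField … (s + τ) = cellField …`.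
* §2 **`exists_sol_forall_fcoeff_eq_modeRep`** — for a propagator `U` of the cell problem (carrier `W₁.cell n`, tensor `𝔹 ∈ NearIso lo′ hi′`, `lo′ > 0`)
  on `[0,T₀]`, a window start `s` at which the carrier is back at phase 0, and an `L²` weakly divergence-free datum `F`: there is a Lions weak solution
  `u` of the cell problem on `(0, T₀ − s)` from `F` such that for EVERY `τ ∈ [0, T₀ − s]` and every frequency `k`
  `𝓕(U s (s+τ) (toLp F))(k) = modeRep W₁ n 𝔹 F u k τ` (`IsPropagator.repr` + `CellChain.ae_forall_eq_modeRep` a.e., then weak continuity of the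
  orbit and continuity of the representative on the closed window).  With `n = 0` (`W₁.cell 0 = 0`) the same lemma serves the carrier-free member.
`sorry`-free; NOT a proof of (ss), of the stub, of K1L_D or of AD; rung F-D1.A0.
-/

set_option linter.dupNamespace false

noncomputable section

namespace Summit.AnomalousDissipation.AnomalousDissipation.Theorems.SolenoidalFractalHomogenisation.LagrangianStep.VmodGen

open Set MeasureTheory Complex UnitAddTorus
open scoped InnerProductSpace ENNReal
open Literature.Analysis Literature.Analysis.FunctionSpaces Literature.Analysis.FunctionSpaces.Torus
open Literature.Analysis.FluidPDE Literature.Analysis.FluidPDE.Torus Literature.Analysis.FluidPDE.LatticeShear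
open Summit.AnomalousDissipation.AnomalousDissipation.Theorems.SolenoidalFractalHomogenisation.LagrangianStep.CellChain
  (modeRep continuousOn_modeRep ae_forall_eq_modeRep le_on_Icc_of_ae_le)
open Summit.AnomalousDissipation.AnomalousDissipation.Theorems.SolenoidalFractalHomogenisation.RealisedQuasiStaticCellLaw
  (isSmooth_cell isDivFree_cell memLp_top_stLift_cell)
open Summit.AnomalousDissipation.AnomalousDissipation.Theorems.SolenoidalFractalHomogenisation.PermissibleCarrier
  (period_pos period_stretch carrier_add_period)

variable {k₀ : ℕ}

/-! ## §1 The cell carrier is periodic in time -/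

/-- The cell carrier is periodic in time with the word's period (`PermissibleCarrier.carrier_add_period`). [folklore] -/
theorem cell_add_period (W : LatticeWord k₀) (n : ℕ) (t : ℝ) : W.cell n (t + W.period) = W.cell n t := by
  funext x
  simp only [LatticeWord.cell, carrier_add_period]

/-- … hence with every natural multiple of the period. [folklore] -/
theorem cell_add_nat_mul_period (W : LatticeWord k₀) (n : ℕ) (j : ℕ) (t : ℝ) : W.cell n (t + j * W.period) = W.cell n t := by
  induction j with
  | zero => simp
  | succ j ih =>
      have e : t + ((j + 1 : ℕ) : ℝ) * W.period = (t + j * W.period) + W.period := by push_cast; ring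
      rw [e, cell_add_period, ih]

/-- The period of the quasi-statically replayed design: `((W.stretch M).stretch (1/ν)).period = M·W.period/ν`
(`PermissibleCarrier.period_stretch` twice; the same formula as `Sideband.period_stretch_stretch`, restated here to keep the imports of the bridge light).
[folklore] -/
theorem period_stretch_stretch (W : LatticeWord k₀) (M : ℝ) (hM : 0 < M) (ν : ℝ) (hν : 0 < ν) :
    ((W.stretch M hM).stretch (1 / ν) (one_div_pos.mpr hν)).period = M * W.period / ν := by
  rw [period_stretch, period_stretch]; field_simp

/-- **The cell carrier of the design comes back to phase 0 at every multiple of `P = M·W.period/ν`**: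
`cellField W M hM ν hν n (j·P + τ) = cellField W M hM ν hν n τ`. [folklore] -/
theorem cellField_add_nat_mul_period (W : LatticeWord k₀) (M : ℝ) (hM : 0 < M) (ν : ℝ) (hν : 0 < ν) (n : ℕ) (j : ℕ) (τ : ℝ) :
    cellField W M hM ν hν n (j * (M * W.period / ν) + τ) = cellField W M hM ν hν n τ := by
  show ((W.stretch M hM).stretch (1 / ν) (one_div_pos.mpr hν)).cell n _ = ((W.stretch M hM).stretch (1 / ν) (one_div_pos.mpr hν)).cell n τ
  rw [← period_stretch_stretch W M hM ν hν, add_comm]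
  exact cell_add_nat_mul_period _ n j τ

/-! ## §2 The orbit of a window propagator IS the family of continuous mode representatives of a Lions solution -/

/-- The `k`-th Fourier coefficient of a weakly continuous `V2`-valued family is continuous (coordinatewise `modeCoeff`). [folklore] -/
theorem continuousOn_fcoeff_of_weakly_continuous {G : ℝ → V2} {Iv : Set ℝ}
    (hG : ∀ z : V2, ContinuousOn (fun t => ⟪G t, z⟫_ℝ) Iv) (k : Fin 3 → ℤ) (i : Fin 3) :
    ContinuousOn (fun t => mFourierCoeff (FunctionSpaces.EuclideanSpace.complexify ∘ ⇑(G t)) k i) Iv := by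
  have h := PropagatorSymm.continuousOn_modeCoeff_of_weakly_continuous hG k i
  refine h.congr fun t _ => ?_
  exact (modeCoeff_eq (integrable_coe_V2 (G t)) k i).symm

/-- **PROPAGATOR ↔ MODE REPRESENTATIVES.**  Let `U` be a propagator of the cell problem (carrier `W₁.cell n`, tensor `𝔹 ∈ NearIso lo′ hi′`, `lo′ > 0`)
on `[0,T₀]`, `0 ≤ s < T₀` a window start at which the carrier is back at phase 0 (`W₁.cell n (s + τ) = W₁.cell n τ`), `F ∈ L²` weakly divergence
free.  Then some Lions weak solution `u` of the cell problem on `(0, T₀ − s)` from `F` has, for EVERY `τ ∈ [0, T₀ − s]` and every `k`,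
`𝓕(U s (s+τ) (toLp F))(k) = modeRep W₁ n 𝔹 F u k τ`.
[cite: LionsMagenes1972, Chap. 3 Thm. 1.1] [cite: Pazy1983, Ch. 5 §5.1 Def. 5.3] -/
theorem exists_sol_forall_fcoeff_eq_modeRep (W₁ : LatticeWord k₀) (n : ℕ) {T₀ : ℝ} {𝔹 : Visc4 (Fin 3)} {lo' hi' : ℝ}
    (h𝔹 : NearIso 𝔹 lo' hi') (hlo' : 0 < lo')
    {U : ℝ → ℝ → (V2 →L[ℝ] V2)} (hU : IsPropagator T₀ (W₁.cell n) 𝔹 U)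
    {s : ℝ} (hs : 0 ≤ s) (hsT : s < T₀) (hphase : ∀ τ, W₁.cell n (s + τ) = W₁.cell n τ)
    {F : UnitAddTorus (Fin 3) → EuclideanSpace ℝ (Fin 3)} (hF2 : MemLp F 2 volume) (hFdiv : FunctionSpaces.Torus.IsWeaklyDivFree F) :
    ∃ u : ℝ → UnitAddTorus (Fin 3) → EuclideanSpace ℝ (Fin 3),
      IsWeakTensorPassiveVectorOn 0 (T₀ - s) 𝔹 (W₁.cell n) F u ∧
      ∀ τ ∈ Icc 0 (T₀ - s), ∀ k : Fin 3 → ℤ,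
        mFourierCoeff (FunctionSpaces.EuclideanSpace.complexify ∘ ⇑(U s (s + τ) (hF2.toLp F))) k = modeRep W₁ n 𝔹 F u k τ := by
  set L : ℝ := T₀ - s with hL
  have hL0 : 0 < L := by rw [hL]; linarith
  have hFi : Integrable F volume := hF2.integrable one_le_two
  -- a Lions weak solution of the cell problem from `F` on `(0, L)`
  have hb : MemLp (FunctionSpaces.Torus.stLift (W₁.cell n)) ∞ (volume.restrict (Ioo 0 L ×ˢ (univ : Set (EuclideanSpace ℝ (Fin 3))))) :=
    memLp_top_stLift_cell W₁ n L
  have hbdiv : ∀ᵐ τ ∂(volume.restrict (Ioo (0:ℝ) L)), FunctionSpaces.Torus.IsWeaklyDivFree (W₁.cell n τ) :=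
    ae_of_all _ fun τ => (isDivFree_cell W₁ n τ).isWeaklyDivFree_holds (isSmooth_cell W₁ n τ)
  obtain ⟨u, hu⟩ := Torus.exists_isWeakTensorPassiveVectorOn hL0 h𝔹 hlo' hb hbdiv hF2 hFdiv
  refine ⟨u, hu, ?_⟩
  -- the shifted carrier is the carrier: `repr` applies
  have hcar : (fun τ => W₁.cell n (s + τ)) = W₁.cell n := funext hphase
  have hu' : IsWeakTensorPassiveVectorOn 0 (T₀ - s) 𝔹 (fun τ => W₁.cell n (s + τ)) F u := by rw [hcar]; exact hu
  have hrepr := hU.repr s hs hsT F hF2 hFdiv u hu'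
  have hrep := ae_forall_eq_modeRep W₁ n hL0.le hu hFi
  -- a.e. on `(0, L)`: the orbit's coefficients are the representatives
  have hae : ∀ᵐ τ ∂(volume.restrict (Ioo 0 L)), ∀ k,
      mFourierCoeff (FunctionSpaces.EuclideanSpace.complexify ∘ ⇑(U s (s + τ) (hF2.toLp F))) k = modeRep W₁ n 𝔹 F u k τ := by
    filter_upwards [hrepr, hrep] with τ hτ hτ' k
    obtain ⟨hm, he⟩ := hτ
    rw [← he, FunctionSpaces.Torus.mFourierCoeff_congr_ae (Filter.EventuallyEq.fun_comp (MemLp.coeFn_toLp hm) FunctionSpaces.EuclideanSpace.complexify) k]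
    exact hτ' k
  -- both sides are continuous on `[0, L]`: upgrade to every `τ`, coordinate by coordinate
  have hmaps : MapsTo (fun τ : ℝ => s + τ) (Icc 0 L) (Icc s T₀) := fun τ hτ => ⟨by linarith [hτ.1], by rw [hL] at hτ; linarith [hτ.2]⟩
  have hw : ∀ z : V2, ContinuousOn (fun τ => ⟪U s (s + τ) (hF2.toLp F), z⟫_ℝ) (Icc 0 L) := fun z =>
    (hU.continuousOn s hs hsT.le (hF2.toLp F) z).comp (continuous_const.add continuous_id).continuousOn hmaps
  intro τ hτ k
  ext i
  have hfc : ContinuousOn (fun τ => mFourierCoeff (FunctionSpaces.EuclideanSpace.complexify ∘ ⇑(U s (s + τ) (hF2.toLp F))) k i) (Icc 0 L) :=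
    continuousOn_fcoeff_of_weakly_continuous hw k i
  have hrc : ContinuousOn (fun τ => (modeRep W₁ n 𝔹 F u k τ) i) (Icc 0 L) :=
    (EuclideanSpace.proj (𝕜 := ℂ) i).continuous.comp_continuousOn (continuousOn_modeRep W₁ n hL0.le hu k)
  have hdiff : ContinuousOn (fun τ => ‖mFourierCoeff (FunctionSpaces.EuclideanSpace.complexify ∘ ⇑(U s (s + τ) (hF2.toLp F))) k i -
      (modeRep W₁ n 𝔹 F u k τ) i‖) (Icc 0 L) := (hfc.sub hrc).norm
  have hae' : ∀ᵐ τ ∂(volume.restrict (Ioo 0 L)), ‖mFourierCoeff (FunctionSpaces.EuclideanSpace.complexify ∘ ⇑(U s (s + τ) (hF2.toLp F))) k i -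
      (modeRep W₁ n 𝔹 F u k τ) i‖ ≤ 0 := by
    filter_upwards [hae] with τ hτk
    rw [hτk k, sub_self, norm_zero]
  have h0 := le_on_Icc_of_ae_le hL0 hdiff continuousOn_const hae' τ hτ
  have h1 : ‖mFourierCoeff (FunctionSpaces.EuclideanSpace.complexify ∘ ⇑(U s (s + τ) (hF2.toLp F))) k i - (modeRep W₁ n 𝔹 F u k τ) i‖ = 0 :=
    le_antisymm h0 (norm_nonneg _)
  exact sub_eq_zero.1 (norm_eq_zero.1 h1)

/-- **The carrier-free member through the same bridge** (`W₁.cell 0 = 0`): for a propagator `T` of the carrier-free problem with tensor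
`𝔹 ∈ NearIso lo′ hi′`, `lo′ > 0`, every window start `0 ≤ s < T₀` and every `L²` weakly divergence-free `F`, some Lions solution `w` of the problem
with carrier `W₁.cell 0` has `𝓕(T s (s+τ) (toLp F))(k) = modeRep W₁ 0 𝔹 F w k τ` for every `τ ∈ [0, T₀ − s]`, `k`.
[cite: LionsMagenes1972, Chap. 3 Thm. 1.1] [cite: Pazy1983, Ch. 5 §5.1 Def. 5.3] -/
theorem exists_sol_forall_fcoeff_eq_modeRep_free (W₁ : LatticeWord k₀) {T₀ : ℝ} {𝔹 : Visc4 (Fin 3)} {lo' hi' : ℝ}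
    (h𝔹 : NearIso 𝔹 lo' hi') (hlo' : 0 < lo')
    {T : ℝ → ℝ → (V2 →L[ℝ] V2)}
    (hT : IsPropagator T₀ (fun (_ : ℝ) (_ : UnitAddTorus (Fin 3)) => (0 : EuclideanSpace ℝ (Fin 3))) 𝔹 T)
    {s : ℝ} (hs : 0 ≤ s) (hsT : s < T₀)
    {F : UnitAddTorus (Fin 3) → EuclideanSpace ℝ (Fin 3)} (hF2 : MemLp F 2 volume) (hFdiv : FunctionSpaces.Torus.IsWeaklyDivFree F) :
    ∃ w : ℝ → UnitAddTorus (Fin 3) → EuclideanSpace ℝ (Fin 3),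
      IsWeakTensorPassiveVectorOn 0 (T₀ - s) 𝔹 (W₁.cell 0) F w ∧
      ∀ τ ∈ Icc 0 (T₀ - s), ∀ k : Fin 3 → ℤ,
        mFourierCoeff (FunctionSpaces.EuclideanSpace.complexify ∘ ⇑(T s (s + τ) (hF2.toLp F))) k = modeRep W₁ 0 𝔹 F w k τ := by
  have hcell : W₁.cell 0 = fun (_ : ℝ) (_ : UnitAddTorus (Fin 3)) => (0 : EuclideanSpace ℝ (Fin 3)) := by
    funext t x; simp [LatticeWord.cell]
  have hT' : IsPropagator T₀ (W₁.cell 0) 𝔹 T := by rw [hcell]; exact hT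
  exact exists_sol_forall_fcoeff_eq_modeRep W₁ 0 h𝔹 hlo' hT' hs hsT (fun τ => by rw [hcell]) hF2 hFdiv

end Summit.AnomalousDissipation.AnomalousDissipation.Theorems.SolenoidalFractalHomogenisation.LagrangianStep.VmodGen

end
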